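import Literature.AlgebraicGeometry.Deligne1982.WeilTypeCMGeneralMemberWeilClassesNotLefschetz
import Literature.AlgebraicGeometry.VanGeemen1994.WeilTypeGeneralMemberIsogenyClass
import Literature.AlgebraicGeometry.HodgeTheory.ExceptionalClassesProductFactors
import HarnessLib

/-!
# Every power of (and every product with) a general Weil-type abelian variety carries exotic Hodge classes

Milne [Milne1999LefschetzClasses, §4 Prop. 4.8]: «The following conditions on an abelian variety `A` are equivalent:
(a) no power of `A` supports an exotic Hodge class; (b) `Hg(A) = L(A)`». For a GENERAL polarized abelian variety of
Weil type — relative to an imaginary quadratic field `K` (van Geemen's `Hg(A) = SU_H`, `dim A = 2n`, `n ≥ 2`,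
[vanGeemen1994HodgeAV, Thm. 4.11 and 6.12]) or to a CM field `E` (Deligne–Milne's `Hg(A) = SU(φ)`,
`dim_E H¹(A, ℚ) = 2k`, `k ≥ 2`, [Deligne1982HodgeCycles, endnote 16]; Milne's «the Weil classes are Hodge classes but not
Lefschetz classes», [Milne2025AbelianMotivesCharP, Ex. 1.17]) — the first power already supports an exotic (=
exceptional, [vanGeemen1994HodgeAV, 2.5]) Hodge class (tree `VanGeemen1994.not_isDivisorGenerated_of_hasHodgeGroupSU`,
`Deligne1982.IsWeilTypeCM.not_isDivisorGenerated_of_hodgeGroupSU`). This file records the elementary propagation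
«an exceptional class of `T` pulls back along `pr_T` to an exceptional class of `T × Y`» (Moonen–Zarhin; tree
`AbelianVariety.map_fst_not_mem_divisorClassesSpan`, `IsDivisorGenerated.left_of_prod`) to ALL POWERS `A^{N+1}` and
all products `A × B`, `B × A`, and to everything isogenous to them: none of these has its Hodge ring generated by
divisor classes.

## What is proved (all `theorem`s; no definition, no named fact)

* §1 (any complex abelian variety) **`isDivisorGenerated_of_isDivisorGenerated_powSucc`** (`B = D` for `A^{N+1}` forces
  `B = D` for `A`), `not_isDivisorGenerated_powSucc`, `not_isDivisorGenerated_prod_left/right`,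
  **`exists_exceptional_powSucc`** (an exceptional rational `(p,p)`-class on `A` pulls back to one on every `A^{N+1}`).
* §2 (the general CM-Weil member, `k ≥ 2`) **`IsWeilTypeCM.not_isDivisorGenerated_powSucc_of_hodgeGroupSU`**,
  `IsWeilTypeCM.exists_exceptional_powSucc_of_hodgeGroupSU` (an explicit exotic class in degree `2k` on every power),
  `IsWeilTypeCM.not_isDivisorGenerated_prod_left/right_of_hodgeGroupSU`,
  `not_isDivisorGenerated_of_isIsogenous_powSucc_of_hasHodgeGroupSUCM`.
* §3 (van Geemen's general member, `K` imaginary quadratic, `n ≥ 2`) `VanGeemen1994.not_isDivisorGenerated_powSucc_of_hasHodgeGroupSU`,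
  `VanGeemen1994.not_isDivisorGenerated_prod_left/right_of_hasHodgeGroupSU`,
  `VanGeemen1994.not_isDivisorGenerated_of_isIsogenous_powSucc_of_hasHodgeGroupSU`.

## References

* [Milne1999LefschetzClasses] J. S. Milne, *Lefschetz classes on abelian varieties*, Duke Math. J. 96 (1999), §4 p. 660,
  Prop. 4.8 (exotic Hodge classes on powers; `Hg(A) = L(A)`).
* [vanGeemen1994HodgeAV] B. van Geemen, LNM 1594 (1994), 2.4–2.5 (p. 235: `Dᵖ ⊂ Bᵖ`, exceptional classes), 3.6
  (p. 236), Thm. 4.11, Thm. 6.12.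
* [Deligne1982HodgeCycles] P. Deligne (notes by J. S. Milne), LNM 900 (1982), §4; Milne's 2003 re-edition, endnote 16.
* [Milne2025AbelianMotivesCharP] J. S. Milne, arXiv:2508.09972, §1.5 Example 1.17.
* [MoonenZarhin1999LowDim] B. Moonen, Yu. Zarhin, *Hodge classes on abelian varieties of low dimension*, Math. Ann. 315
  (1999), §1 (exceptional classes; products).
* [Gordon1999HodgeAVSurvey] B. B. Gordon, *A survey of the Hodge conjecture for abelian varieties* (1999), Def. 7.6.
-/

noncomputable section

open CategoryTheory Polynomial MonoidalCategory
open Literature.AlgebraicTopology.SingularHomology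
open Literature.AlgebraicGeometry.Motives
open Literature.AlgebraicGeometry.HodgeTheory
open Literature.Barriers.HodgeConjecture (divisorClassesSpan)

/-! ### §1 Exceptional classes persist on powers and products -/

namespace Literature.AlgebraicGeometry.Deligne1982

section Powers

variable {A : AbelianVariety ℂ}

/-- **`B = D` for `A^{N+1}` forces `B = D` for `A`** (`A^{N+1} = A^N × A`; restrict to a slice, tree
`IsDivisorGenerated.left_of_prod`). [cite: vanGeemen1994HodgeAV, §2.4–2.5 (p. 235) and §3.6 (p. 236)]
[cite: MoonenZarhin1999LowDim, §1] -/
theorem isDivisorGenerated_of_isDivisorGenerated_powSucc : ∀ N : ℕ, IsDivisorGenerated (A.powSucc N) → IsDivisorGenerated A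
  | 0, h => h
  | N + 1, h => isDivisorGenerated_of_isDivisorGenerated_powSucc N (IsDivisorGenerated.left_of_prod h)

/-- **An abelian variety with an exotic Hodge class has exotic Hodge classes on all its powers.**
[cite: Milne1999LefschetzClasses, §4 p. 660 and Prop. 4.8] [cite: vanGeemen1994HodgeAV, §2.5 (p. 235)] -/
theorem not_isDivisorGenerated_powSucc (h : ¬ IsDivisorGenerated A) (N : ℕ) : ¬ IsDivisorGenerated (A.powSucc N) :=
  fun hN => h (isDivisorGenerated_of_isDivisorGenerated_powSucc N hN)

/-- … and on every product `A × B`. [cite: MoonenZarhin1999LowDim, §1] [cite: vanGeemen1994HodgeAV, §2.5 (p. 235)] -/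
theorem not_isDivisorGenerated_prod_left (h : ¬ IsDivisorGenerated A) (B : AbelianVariety ℂ) :
    ¬ IsDivisorGenerated (A.prod B) := fun hAB => h hAB.left_of_prod

/-- … and on every product `B × A`. [cite: MoonenZarhin1999LowDim, §1] [cite: vanGeemen1994HodgeAV, §2.5 (p. 235)] -/
theorem not_isDivisorGenerated_prod_right (h : ¬ IsDivisorGenerated A) (B : AbelianVariety ℂ) :
    ¬ IsDivisorGenerated (B.prod A) := fun hBA => h hBA.right_of_prod

/-- **An exceptional class propagates to all powers**: a rational `(p,p)`-class of `A` outside `Dᵖ(A) ⊗ ℂ` pulls back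
along the last projection `A^{N+1} = A^N × A → A` to a rational `(p,p)`-class of `A^{N+1}` outside `Dᵖ(A^{N+1}) ⊗ ℂ`
(tree `AbelianVariety.map_snd_not_mem_divisorClassesSpan`). [cite: MoonenZarhin1999LowDim, §1]
[cite: vanGeemen1994HodgeAV, §2.5 (p. 235) and §3.6 (p. 236)] -/
theorem exists_exceptional_powSucc {p : ℕ}
    (h : ∃ c : complexBetti A.X (2 * p), IsRationalClass c ∧ IsOfHodgeType A.dim A.X (2 * p) p p c ∧
      c ∉ divisorClassesSpan A.X A.dim p) :
    ∀ N : ℕ, ∃ c : complexBetti (A.powSucc N).X (2 * p),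
      IsRationalClass c ∧ IsOfHodgeType (A.powSucc N).dim (A.powSucc N).X (2 * p) p p c ∧
        c ∉ divisorClassesSpan (A.powSucc N).X (A.powSucc N).dim p
  | 0 => h
  | N + 1 => by
    obtain ⟨c, hc, hpp, hcD⟩ := h
    have hA : IsSmoothProjective A.dim A.X := AbelianVariety.isSmoothProjective_holds
    have hP : IsSmoothProjective ((A.powSucc N).prod A).dim ((A.powSucc N).prod A).X :=
      AbelianVariety.isSmoothProjective_holds
    have hc' := mapsTo_hodgeClasses hP hA (CartesianMonoidalCategory.snd (A.powSucc N).X A.X) p ⟨hc, hpp⟩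
    exact ⟨_, hc'.1, hc'.2, AbelianVariety.map_snd_not_mem_divisorClassesSpan (T := A.powSucc N) hcD⟩

end Powers

/-! ### §2 The general CM-Weil member: exotic classes on all powers and products -/

section CM

variable {A : AbelianVariety ℂ} {η : A ⟶ A} {R : Polynomial ℤ} {e₀ k : ℕ} {h : complexBetti A.X 2}
variable (hW : IsWeilTypeCM A η R e₀ k) (hpol : IsPolarizationClass A.dim A.X h) (hRos : IsRosatiCM A η h)

include hW hpol hRos

/-- **No power of the general CM-Weil abelian variety (`k ≥ 2`) has its Hodge ring generated by divisor classes**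
(«no power of `A` supports an exotic Hodge class ⟺ Hg(A) = L(A)»; here `Hg(A) = SU(φ) ≠ L(A) ⊇ U(φ)`).
[cite: Milne1999LefschetzClasses, §4 Prop. 4.8] [cite: Milne2025AbelianMotivesCharP, §1.5 Example 1.17]
[cite: Deligne1982HodgeCycles, Milne 2003 re-edition endnote 16] -/
theorem IsWeilTypeCM.not_isDivisorGenerated_powSucc_of_hodgeGroupSU (hk : 2 ≤ k)
    (hSU : HasHodgeGroupSUCM A η (R.comp (X ^ 2)) h) (N : ℕ) : ¬ IsDivisorGenerated (A.powSucc N) :=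
  not_isDivisorGenerated_powSucc (hW.not_isDivisorGenerated_of_hodgeGroupSU hpol hRos hk hSU) N

/-- **An explicit exotic class on every power**: a rational `(k,k)`-class of `A^{N+1}` outside `Dᵏ(A^{N+1}) ⊗ ℂ` — the
pull-back of a rational exceptional Weil class of `A` (tree `IsWeilTypeCM.exists_weilClass_not_mem_divisorClassesSpan_of_hodgeGroupSU`).
[cite: Milne1999LefschetzClasses, §4 p. 660 and Prop. 4.8] [cite: Milne2025AbelianMotivesCharP, §1.5 Example 1.17]
[cite: MoonenZarhin1999LowDim, §1] -/
theorem IsWeilTypeCM.exists_exceptional_powSucc_of_hodgeGroupSU (hk : 2 ≤ k)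
    (hSU : HasHodgeGroupSUCM A η (R.comp (X ^ 2)) h) (N : ℕ) :
    ∃ c : complexBetti (A.powSucc N).X (2 * k),
      IsRationalClass c ∧ IsOfHodgeType (A.powSucc N).dim (A.powSucc N).X (2 * k) k k c ∧
        c ∉ divisorClassesSpan (A.powSucc N).X (A.powSucc N).dim k := by
  obtain ⟨c, -, hcQ, hck, hcD⟩ := hW.exists_weilClass_not_mem_divisorClassesSpan_of_hodgeGroupSU hpol hRos hk hSU
  exact exists_exceptional_powSucc ⟨c, hcQ, hck, hcD⟩ N

/-- **No product `A × B` with the general CM-Weil member `A` (`k ≥ 2`) is divisor-generated.**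
[cite: MoonenZarhin1999LowDim, §1] [cite: Deligne1982HodgeCycles, Milne 2003 re-edition endnote 16] -/
theorem IsWeilTypeCM.not_isDivisorGenerated_prod_left_of_hodgeGroupSU (hk : 2 ≤ k)
    (hSU : HasHodgeGroupSUCM A η (R.comp (X ^ 2)) h) (B : AbelianVariety ℂ) : ¬ IsDivisorGenerated (A.prod B) :=
  not_isDivisorGenerated_prod_left (hW.not_isDivisorGenerated_of_hodgeGroupSU hpol hRos hk hSU) B

/-- **No product `B × A` with the general CM-Weil member `A` (`k ≥ 2`) is divisor-generated.**
[cite: MoonenZarhin1999LowDim, §1] [cite: Deligne1982HodgeCycles, Milne 2003 re-edition endnote 16] -/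
theorem IsWeilTypeCM.not_isDivisorGenerated_prod_right_of_hodgeGroupSU (hk : 2 ≤ k)
    (hSU : HasHodgeGroupSUCM A η (R.comp (X ^ 2)) h) (B : AbelianVariety ℂ) : ¬ IsDivisorGenerated (B.prod A) :=
  not_isDivisorGenerated_prod_right (hW.not_isDivisorGenerated_of_hodgeGroupSU hpol hRos hk hSU) B

/-- **Nothing isogenous to a power of the general CM-Weil member (`k ≥ 2`) is divisor-generated** (`B = D` is an
isogeny invariant, tree `isDivisorGenerated_iff_of_isIsogenous`). [cite: vanGeemen1994HodgeAV, §3.6 (p. 236)]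
[cite: Milne1999LefschetzClasses, §4 Prop. 4.8] -/
theorem not_isDivisorGenerated_of_isIsogenous_powSucc_of_hasHodgeGroupSUCM {C : AbelianVariety ℂ} (hk : 2 ≤ k)
    (hSU : HasHodgeGroupSUCM A η (R.comp (X ^ 2)) h) {N : ℕ} (hC : AbelianVariety.IsIsogenous C (A.powSucc N)) :
    ¬ IsDivisorGenerated C := fun hD =>
  hW.not_isDivisorGenerated_powSucc_of_hodgeGroupSU hpol hRos hk hSU N ((isDivisorGenerated_iff_of_isIsogenous hC).1 hD)

end CM

end Literature.AlgebraicGeometry.Deligne1982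

/-! ### §3 Van Geemen's general member (`K` imaginary quadratic, `n ≥ 2`): exotic classes on all powers and products -/

namespace Literature.AlgebraicGeometry.VanGeemen1994

open Literature.AlgebraicGeometry.Deligne1982 (not_isDivisorGenerated_powSucc not_isDivisorGenerated_prod_left
  not_isDivisorGenerated_prod_right)

section Quadratic

variable (A : AbelianVariety ℂ) (φ : A ⟶ A) (n d : ℕ) (e : ProjectiveEmbedding A.X)
  (a : complexBetti (projectiveSpace e.n ℂ) 2) {C : AbelianVariety ℂ}

/-- **No power of van Geemen's general Weil-type abelian variety (`Hg = SU_H`, `n ≥ 2`) is divisor-generated**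
(exceptional classes `W_K` on the first power, tree `not_isDivisorGenerated_of_hasHodgeGroupSU`; propagation §1).
[cite: vanGeemen1994HodgeAV, Thm. 4.11 and Thm. 6.12] [cite: Milne1999LefschetzClasses, §4 Prop. 4.8] -/
theorem not_isDivisorGenerated_powSucc_of_hasHodgeGroupSU (hn : 2 ≤ n) (hd : 0 < d) (hA : A.dim = 2 * n)
    (hφ : φ ≫ φ = -(d • 𝟙 A)) (ha : IsRationalClass a) (ha0 : a ≠ 0) (hSU : HasHodgeGroupSU A φ n d (hK d φ e a))
    (N : ℕ) : ¬ IsDivisorGenerated (A.powSucc N) :=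
  not_isDivisorGenerated_powSucc (not_isDivisorGenerated_of_hasHodgeGroupSU A φ n d e a hn hd hA hφ ha ha0 hSU) N

/-- **No product `A × B` with van Geemen's general member `A` is divisor-generated.** [cite: vanGeemen1994HodgeAV, Thm. 4.11 and Thm. 6.12]
[cite: MoonenZarhin1999LowDim, §1] -/
theorem not_isDivisorGenerated_prod_left_of_hasHodgeGroupSU (hn : 2 ≤ n) (hd : 0 < d) (hA : A.dim = 2 * n)
    (hφ : φ ≫ φ = -(d • 𝟙 A)) (ha : IsRationalClass a) (ha0 : a ≠ 0) (hSU : HasHodgeGroupSU A φ n d (hK d φ e a))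
    (B : AbelianVariety ℂ) : ¬ IsDivisorGenerated (A.prod B) :=
  not_isDivisorGenerated_prod_left (not_isDivisorGenerated_of_hasHodgeGroupSU A φ n d e a hn hd hA hφ ha ha0 hSU) B

/-- **No product `B × A` with van Geemen's general member `A` is divisor-generated.** [cite: vanGeemen1994HodgeAV, Thm. 4.11 and Thm. 6.12]
[cite: MoonenZarhin1999LowDim, §1] -/
theorem not_isDivisorGenerated_prod_right_of_hasHodgeGroupSU (hn : 2 ≤ n) (hd : 0 < d) (hA : A.dim = 2 * n)
    (hφ : φ ≫ φ = -(d • 𝟙 A)) (ha : IsRationalClass a) (ha0 : a ≠ 0) (hSU : HasHodgeGroupSU A φ n d (hK d φ e a))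
    (B : AbelianVariety ℂ) : ¬ IsDivisorGenerated (B.prod A) :=
  not_isDivisorGenerated_prod_right (not_isDivisorGenerated_of_hasHodgeGroupSU A φ n d e a hn hd hA hφ ha ha0 hSU) B

/-- **Nothing isogenous to a power of van Geemen's general member is divisor-generated.**
[cite: vanGeemen1994HodgeAV, §3.6 (p. 236), Thm. 4.11 and Thm. 6.12] [cite: Milne1999LefschetzClasses, §4 Prop. 4.8] -/
theorem not_isDivisorGenerated_of_isIsogenous_powSucc_of_hasHodgeGroupSU (hn : 2 ≤ n) (hd : 0 < d)
    (hA : A.dim = 2 * n) (hφ : φ ≫ φ = -(d • 𝟙 A)) (ha : IsRationalClass a) (ha0 : a ≠ 0)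
    (hSU : HasHodgeGroupSU A φ n d (hK d φ e a)) {N : ℕ} (hC : AbelianVariety.IsIsogenous C (A.powSucc N)) :
    ¬ IsDivisorGenerated C := fun hD =>
  not_isDivisorGenerated_powSucc_of_hasHodgeGroupSU A φ n d e a hn hd hA hφ ha ha0 hSU N
    ((isDivisorGenerated_iff_of_isIsogenous hC).1 hD)

end Quadratic

end Literature.AlgebraicGeometry.VanGeemen1994

end
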